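import Summits.CriticalPhenomena.SAWScalingLimit.Theorems.SAWRenewalTightnessTubeLowerBoundDefs
import Literature.Probability.RandomPlanarGeometry.SAWReflect

/-!
# Crux `SAWRenewalTightness.TubeLowerBound` (stmt-CriticalPhenomena-4730), line `lieb-simon-star`:
helpers for the stub `steeredChain` (box families, mirror, gluing)

Combinatorial infrastructure for `stub_steeredChain : CornerCrossingFloor → OneSidedReach`
(file `SAWRenewalTightnessTubeLowerBoundSteeredChain.lean`), over the tree vocabulary `SAW.Zd.saws`
(self-avoiding walks from `0` as frozen vertex functions), `SAW.Zd.concatWalk`, `SAW.Zd.straightWalk`,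
`SAW.Zd.reflAt`, `SAW.criticalFugacity`; no new definitions, only two local notations (repeated verbatim in
the stub file) and theorems in the sub-namespace `…LiebSimonStar.SteeredChain`:

* `boxAt(w, lo, hi, n)` — the `n`-step self-avoiding walks from `0` confined to the columns `0 ≤ x ≤ w` and
  the height window `lo ≤ y ≤ hi` whose last vertex is on the column `x = w` (the family of
  `CornerCrossingFloor` at width `a` is `boxAt(a, 0, K a, n)`), and its partial `x_c`-mass
  `bmass(w, lo, hi, N) = Σ_{n ≤ N} Σ_{ω ∈ boxAt(w, lo, hi, n)} x_c^n`;
* the mirror `y ↦ -y`, `ω ↦ (i ↦ Zd.reflAt 1 0 (ω i))` (`bmass_mirror`: the windows `[-hi, -lo]` and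
  `[lo, hi]` carry equal masses);
* the gluing `Zd.concatWalk m ω (Zd.concatWalk 1 (Zd.straightWalk 2 1) υ)` of a head `ω`, one east edge
  and a tail `υ` (`glue_mem_saws` by column separation; `glue_mem_boxAt`; `glue_decode`: the cut time is
  the first visit to the column `x = w + 1`), and the mass inequality `glue_mass` /
  `steeredChain_glue_mass` (registered sub-goal): a weight-preserving injection of pairs (head, tail) into
  the long box, so that masses multiply along a chain.

Only `0 < x_c ≤ 1` is used about the fugacity.
-/

noncomputable section

namespace Summit.CriticalPhenomena.SAWScalingLimit.Theorems.TubeLowerBound.LiebSimonStar.SteeredChain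

open scoped BigOperators Classical
open Literature.Probability.LatticeModels
open Literature.Probability.RandomPlanarGeometry Literature.Probability.RandomPlanarGeometry.SAW

-- `quotPrecheck` has no instance for the binder `∀ i ≤ n` inside the notation bodies (pure abbreviations).
set_option quotPrecheck false in
/-- `boxAt(w, lo, hi, n)`: the `n`-step self-avoiding walks from `0` all of whose vertices `(x, y)` satisfy
`0 ≤ x ≤ w`, `lo ≤ y ≤ hi`, and whose last vertex lies on the east column `x = w`. -/
local notation "boxAt(" w ", " lo ", " hi ", " n ")" =>
  Finset.filter (fun ω : ℕ → Site 2 =>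
    (∀ i ≤ n, 0 ≤ ω i 0 ∧ ω i 0 ≤ ((w : ℕ) : ℤ) ∧ lo ≤ ω i 1 ∧ ω i 1 ≤ hi) ∧ ω n 0 = ((w : ℕ) : ℤ))
    (Zd.saws 2 n)

set_option quotPrecheck false in
/-- `bmass(w, lo, hi, N)`: the partial `x_c`-mass `Σ_{n ≤ N} Σ_{ω ∈ boxAt(w, lo, hi, n)} x_c^n`. -/
local notation "bmass(" w ", " lo ", " hi ", " N ")" =>
  ∑ n ∈ Finset.range (N + 1), ∑ _ω ∈ boxAt(w, lo, hi, n), criticalFugacity ^ n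

/-! ### Box families and their partial `x_c`-masses -/

/-- Membership in a box family. -/
theorem mem_boxAt {w : ℕ} {lo hi : ℤ} {n : ℕ} {ω : ℕ → Site 2} :
    ω ∈ boxAt(w, lo, hi, n) ↔ ω ∈ Zd.saws 2 n ∧
      (∀ i ≤ n, 0 ≤ ω i 0 ∧ ω i 0 ≤ (w : ℤ) ∧ lo ≤ ω i 1 ∧ ω i 1 ≤ hi) ∧ ω n 0 = (w : ℤ) :=
  Finset.mem_filter

/-- The coordinate bounds of a box walk hold at all times (the walk is frozen after time `n`). -/
theorem boxAt_bounds {w : ℕ} {lo hi : ℤ} {n : ℕ} {ω : ℕ → Site 2} (h : ω ∈ boxAt(w, lo, hi, n)) (i : ℕ) :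
    0 ≤ ω i 0 ∧ ω i 0 ≤ (w : ℤ) ∧ lo ≤ ω i 1 ∧ ω i 1 ≤ hi := by
  obtain ⟨hω, hb, -⟩ := mem_boxAt.1 h
  rcases le_or_gt i n with hi | hi
  · exact hb i hi
  · rw [(Zd.mem_saws.1 hω).2.1 i hi.le]
    exact hb n le_rfl

/-- Box families are monotone in the height window. -/
theorem boxAt_mono (w : ℕ) {lo hi lo' hi' : ℤ} (hlo : lo' ≤ lo) (hhi : hi ≤ hi') (n : ℕ) :
    boxAt(w, lo, hi, n) ⊆ boxAt(w, lo', hi', n) := by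
  intro ω h
  obtain ⟨hω, hb, he⟩ := mem_boxAt.1 h
  refine mem_boxAt.2 ⟨hω, fun i hi => ?_, he⟩
  obtain ⟨h1, h2, h3, h4⟩ := hb i hi
  exact ⟨h1, h2, hlo.trans h3, h4.trans hhi⟩

/-- `0 < x_c ≤ 1` (only `μ ≥ 1` is used). -/
theorem criticalFugacity_pos_le_one : 0 < criticalFugacity ∧ criticalFugacity ≤ 1 :=
  ⟨criticalFugacity_pos, by
    show (Zd.connectiveConstant 2)⁻¹ ≤ 1
    exact inv_le_one_of_one_le₀ (Zd.one_le_connectiveConstant 2)⟩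

/-- Partial masses of boxes are monotone in the cut-off and in the height window. -/
theorem bmass_mono (w : ℕ) {lo hi lo' hi' : ℤ} {N N' : ℕ} (hN : N ≤ N') (hlo : lo' ≤ lo) (hhi : hi ≤ hi') :
    bmass(w, lo, hi, N) ≤ bmass(w, lo', hi', N') :=
  calc bmass(w, lo, hi, N) ≤ bmass(w, lo', hi', N) :=
        Finset.sum_le_sum fun n _ => Finset.sum_le_sum_of_subset_of_nonneg (boxAt_mono w hlo hhi n)
          fun _ _ _ => pow_nonneg criticalFugacity_pos.le n
    _ ≤ bmass(w, lo', hi', N') :=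
        Finset.sum_le_sum_of_subset_of_nonneg (Finset.range_mono (by omega))
          fun n _ _ => Finset.sum_nonneg fun _ _ => pow_nonneg criticalFugacity_pos.le n

/-! ### The mirror `y ↦ -y` -/

/-- The mirror image `i ↦ reflAt 1 0 (ω i)` of a self-avoiding walk from `0` is a self-avoiding walk from `0`. -/
theorem mirror_mem_saws {n : ℕ} {ω : ℕ → Site 2} (h : ω ∈ Zd.saws 2 n) :
    (fun i => Zd.reflAt 1 0 (ω i)) ∈ Zd.saws 2 n := by
  obtain ⟨h0, hend, hadj, hinj⟩ := Zd.mem_saws.1 h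
  refine Zd.mem_saws.2 ⟨?_, fun i hi => ?_, fun i hi => ?_, fun i hi j hj hij => ?_⟩
  · funext j
    fin_cases j <;> simp [h0]
  · simp only [hend i hi]
  · exact (Zd.zdGraph_adj_reflAt 1 0 _ _).2 (hadj i hi)
  · exact hinj hi hj (Zd.reflAt_injective 1 0 hij)

/-- The mirror maps the window `[lo, hi]` onto the window `[-hi, -lo]`. -/
theorem mirror_mem_boxAt {w : ℕ} {lo hi : ℤ} {n : ℕ} {ω : ℕ → Site 2} (h : ω ∈ boxAt(w, lo, hi, n)) :
    (fun i => Zd.reflAt 1 0 (ω i)) ∈ boxAt(w, -hi, -lo, n) := by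
  obtain ⟨hω, hb, he⟩ := mem_boxAt.1 h
  refine mem_boxAt.2 ⟨mirror_mem_saws hω, fun i hi => ?_, by simpa using he⟩
  obtain ⟨h1, h2, h3, h4⟩ := hb i hi
  simp only [ne_eq, zero_ne_one, not_false_eq_true, Zd.reflAt_apply_of_ne, Zd.reflAt_apply_same,
    zero_sub]
  exact ⟨h1, h2, by omega, by omega⟩

/-- **Mirror lemma**: the windows `[-hi, -lo]` and `[lo, hi]` carry the same partial masses. -/
theorem bmass_mirror (w : ℕ) (lo hi : ℤ) (N : ℕ) : bmass(w, -hi, -lo, N) = bmass(w, lo, hi, N) := by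
  refine Finset.sum_congr rfl fun n _ => ?_
  refine Finset.sum_nbij' (fun ω i => Zd.reflAt 1 0 (ω i)) (fun ω i => Zd.reflAt 1 0 (ω i))
    (fun ω h => ?_) (fun ω h => mirror_mem_boxAt h) (fun ω _ => ?_) (fun ω _ => ?_) (fun _ _ => rfl)
  · simpa using mirror_mem_boxAt h
  · funext i; simp
  · funext i; simp

/-! ### Gluing: a piece, one east edge, a tail -/

/-- Before the cut the glued walk `concatWalk m ω (concatWalk 1 (straightWalk 2 1) υ)` is the head. -/
theorem glue_apply_of_le {m : ℕ} (ω υ : ℕ → Site 2) {i : ℕ} (hi : i ≤ m) :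
    Zd.concatWalk m ω (Zd.concatWalk 1 (Zd.straightWalk 2 1) υ) i = ω i := by
  simp [Zd.concatWalk, hi]

/-- After the cut the glued walk is the tail translated to start at `ω m + e₁`. -/
theorem glue_apply_add {m : ℕ} {ω υ : ℕ → Site 2} (hυ0 : υ 0 = 0) (j : ℕ) :
    Zd.concatWalk m ω (Zd.concatWalk 1 (Zd.straightWalk 2 1) υ) (m + 1 + j) =
      ω m + Pi.single 0 1 + υ j := by
  have e1 : Zd.straightWalk 2 1 1 = Pi.single 0 1 := by simp [Zd.straightWalk]
  simp only [Zd.concatWalk, if_neg (show ¬ (m + 1 + j ≤ m) by omega),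
    show m + 1 + j - m = 1 + j by omega]
  rcases Nat.eq_zero_or_pos j with rfl | hj
  · simp [e1, hυ0]
  · rw [if_neg (by omega), show 1 + j - 1 = j by omega, e1, add_assoc]

/-- First coordinate of the glued walk after the cut. -/
theorem glue_apply_add_zero {m : ℕ} {ω υ : ℕ → Site 2} (hυ0 : υ 0 = 0) (j : ℕ) :
    Zd.concatWalk m ω (Zd.concatWalk 1 (Zd.straightWalk 2 1) υ) (m + 1 + j) 0 = ω m 0 + 1 + υ j 0 := by
  simp [glue_apply_add hυ0]

/-- Second coordinate of the glued walk after the cut. -/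
theorem glue_apply_add_one {m : ℕ} {ω υ : ℕ → Site 2} (hυ0 : υ 0 = 0) (j : ℕ) :
    Zd.concatWalk m ω (Zd.concatWalk 1 (Zd.straightWalk 2 1) υ) (m + 1 + j) 1 = ω m 1 + υ j 1 := by
  simp [glue_apply_add hυ0]

/-- The glued walk is self-avoiding when the head never passes its final column and the tail stays in the
closed right half-plane (column separation, `Zd.concatWalk_mem_saws` twice). -/
theorem glue_mem_saws {m n : ℕ} {ω υ : ℕ → Site 2} (hω : ω ∈ Zd.saws 2 m) (hυ : υ ∈ Zd.saws 2 n)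
    (hωx : ∀ i ≤ m, ω i 0 ≤ ω m 0) (hυx : ∀ j ≤ n, 0 ≤ υ j 0) :
    Zd.concatWalk m ω (Zd.concatWalk 1 (Zd.straightWalk 2 1) υ) ∈ Zd.saws 2 (m + 1 + n) := by
  obtain ⟨hυ0, -, -, hυinj⟩ := Zd.mem_saws.1 hυ
  have e1 : ∀ i ≤ 1, Zd.straightWalk 2 1 i 0 = i := fun i hi => by
    simp [Zd.straightWalk, min_eq_left hi]
  have hin : ∀ j, 1 ≤ j → j ≤ 1 + n → 1 ≤ Zd.concatWalk 1 (Zd.straightWalk 2 1) υ j 0 := by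
    intro j hj1 hjn
    simp only [Zd.concatWalk]
    split_ifs with hj
    · rw [e1 j hj]
      exact_mod_cast hj1
    · simp only [Pi.add_apply, e1 1 le_rfl, Nat.cast_one]
      have := hυx (j - 1) (by omega)
      linarith
  have hinner : Zd.concatWalk 1 (Zd.straightWalk 2 1) υ ∈ Zd.saws 2 (1 + n) := by
    refine Zd.concatWalk_mem_saws (Zd.straightWalk_mem_saws 2 1) hυ fun i hi j hj1 hjn heq => ?_
    rcases Nat.eq_zero_or_pos i with rfl | hipos
    · have h0 := congrFun heq 0
      simp only [Pi.add_apply, e1 0 (Nat.zero_le 1), e1 1 le_rfl, Nat.cast_zero, Nat.cast_one] at h0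
      have := hυx j hjn
      linarith
    · obtain rfl : i = 1 := by omega
      have hj0 : υ j = υ 0 := by
        rw [hυ0]
        exact add_eq_left.1 heq.symm
      have := hυinj (show j ≤ n from hjn) (Nat.zero_le n) hj0
      omega
  rw [show m + 1 + n = m + (1 + n) by omega]
  refine Zd.concatWalk_mem_saws hω hinner fun i hi j hj1 hjn heq => ?_
  have h0 := congrFun heq 0
  simp only [Pi.add_apply] at h0
  have := hωx i hi
  have := hin j hj1 hjn
  linarith

/-- **The glued walk lies in the long box.** Head in `boxAt(w, lo, hi, m)` with `[lo, hi] ⊆ [LO, HI]`, tail in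
the box of width `W` with the window `[LO, HI]` re-centred at the head's exit height `e = ω m 1`: the result
lies in `boxAt(w + 1 + W, LO, HI, m + 1 + n)`. -/
theorem glue_mem_boxAt {w W m n : ℕ} {lo hi LO HI : ℤ} {ω υ : ℕ → Site 2} (hlo : LO ≤ lo) (hhi : hi ≤ HI)
    (hω : ω ∈ boxAt(w, lo, hi, m)) (hυ : υ ∈ boxAt(W, LO - ω m 1, HI - ω m 1, n)) :
    Zd.concatWalk m ω (Zd.concatWalk 1 (Zd.straightWalk 2 1) υ) ∈ boxAt(w + 1 + W, LO, HI, m + 1 + n) := by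
  have hbω := boxAt_bounds hω
  have hbυ := boxAt_bounds hυ
  obtain ⟨hωs, -, hωe⟩ := mem_boxAt.1 hω
  obtain ⟨hυs, -, hυe⟩ := mem_boxAt.1 hυ
  have hυ0 : υ 0 = 0 := (Zd.mem_saws.1 hυs).1
  refine mem_boxAt.2 ⟨glue_mem_saws hωs hυs (fun i _ => ?_) (fun j _ => (hbυ j).1), fun i _ => ?_, ?_⟩
  · rw [hωe]
    exact (hbω i).2.1
  · rcases le_or_gt i m with him | him
    · rw [glue_apply_of_le ω υ him]
      obtain ⟨h1, h2, h3, h4⟩ := hbω i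
      exact ⟨h1, by push_cast; linarith, hlo.trans h3, h4.trans hhi⟩
    · obtain ⟨j, rfl⟩ : ∃ j, i = m + 1 + j := ⟨i - (m + 1), by omega⟩
      rw [glue_apply_add_zero hυ0, glue_apply_add_one hυ0, hωe]
      obtain ⟨h1, h2, h3, h4⟩ := hbυ j
      exact ⟨by linarith, by push_cast; linarith, by linarith, by linarith⟩
  · rw [glue_apply_add_zero hυ0, hωe, hυe]
    push_cast
    ring

/-- **Decoding.** The glued walk determines the cut time (the head stays in the columns `x ≤ w` and the
vertex after the cut is on the column `x = w + 1`), hence the head and the tail. -/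
theorem glue_decode {w m m' n n' : ℕ} {lo hi : ℤ} {ω ω' υ υ' : ℕ → Site 2}
    (hω : ω ∈ boxAt(w, lo, hi, m)) (hω' : ω' ∈ boxAt(w, lo, hi, m'))
    (hυ : υ ∈ Zd.saws 2 n) (hυ' : υ' ∈ Zd.saws 2 n')
    (h : Zd.concatWalk m ω (Zd.concatWalk 1 (Zd.straightWalk 2 1) υ) =
      Zd.concatWalk m' ω' (Zd.concatWalk 1 (Zd.straightWalk 2 1) υ')) :
    m = m' ∧ ω = ω' ∧ υ = υ' := by
  have hυ0 : υ 0 = 0 := (Zd.mem_saws.1 hυ).1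
  have hυ0' : υ' 0 = 0 := (Zd.mem_saws.1 hυ').1
  have key : ∀ {m₁ m₂ : ℕ} {ω₁ ω₂ υ₁ υ₂ : ℕ → Site 2}, ω₁ ∈ boxAt(w, lo, hi, m₁) →
      ω₂ ∈ boxAt(w, lo, hi, m₂) → υ₁ 0 = 0 →
      Zd.concatWalk m₁ ω₁ (Zd.concatWalk 1 (Zd.straightWalk 2 1) υ₁) =
        Zd.concatWalk m₂ ω₂ (Zd.concatWalk 1 (Zd.straightWalk 2 1) υ₂) → ¬ m₁ < m₂ := by
    intro m₁ m₂ ω₁ ω₂ υ₁ υ₂ h₁ h₂ h0 he hlt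
    have h3 := congrFun (congrFun he (m₁ + 1 + 0)) 0
    rw [glue_apply_add_zero h0, glue_apply_of_le ω₂ υ₂ (by omega : m₁ + 1 + 0 ≤ m₂), h0,
      (mem_boxAt.1 h₁).2.2] at h3
    have := (boxAt_bounds h₂ (m₁ + 1 + 0)).2.1
    simp only [Pi.zero_apply, add_zero] at h3
    linarith
  have hm : m = m' := by
    by_contra hne
    rcases Nat.lt_or_gt_of_ne hne with hlt | hlt
    · exact key hω hω' hυ0 h hlt
    · exact key hω' hω hυ0' h.symm hlt
  subst hm
  have hωω : ω = ω' := by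
    funext i
    rcases le_or_gt i m with hi | hi
    · have := congrFun h i
      rwa [glue_apply_of_le ω υ hi, glue_apply_of_le ω' υ' hi] at this
    · have := congrFun h m
      rw [glue_apply_of_le ω υ le_rfl, glue_apply_of_le ω' υ' le_rfl] at this
      rw [(Zd.mem_saws.1 (mem_boxAt.1 hω).1).2.1 i hi.le,
        (Zd.mem_saws.1 (mem_boxAt.1 hω').1).2.1 i hi.le, this]
  subst hωω
  refine ⟨rfl, rfl, funext fun j => ?_⟩
  have := congrFun h (m + 1 + j)
  rwa [glue_apply_add hυ0, glue_apply_add hυ0', add_right_inj] at this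

/-- **Gluing multiplies masses.** For the long box `boxAt(w + 1 + W, LO, HI, ·)` cut off at length
`N₁ + 1 + N₂`: its partial mass is at least `x_c` (the joining edge) times the sum over heads
`ω ∈ boxAt(w, lo, hi, m)`, `m ≤ N₁`, of `x_c^m` times the partial mass (cut-off `N₂`) of the width-`W` box
re-centred at the exit height `ω m 1` — the weight-preserving injection (head, tail) ↦ glued walk. -/
theorem glue_mass (w W N₁ N₂ : ℕ) {lo hi LO HI : ℤ} (hlo : LO ≤ lo) (hhi : hi ≤ HI) :
    criticalFugacity * ∑ m ∈ Finset.range (N₁ + 1), ∑ ω ∈ boxAt(w, lo, hi, m),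
        criticalFugacity ^ m * bmass(W, LO - ω m 1, HI - ω m 1, N₂) ≤
      bmass(w + 1 + W, LO, HI, N₁ + 1 + N₂) := by
  set S : Finset (Σ _ : (Σ _ : ℕ, ℕ → Site 2), (Σ _ : ℕ, ℕ → Site 2)) :=
    ((Finset.range (N₁ + 1)).sigma (fun m => boxAt(w, lo, hi, m))).sigma
      (fun p => (Finset.range (N₂ + 1)).sigma
        (fun n => boxAt(W, LO - p.2 p.1 1, HI - p.2 p.1 1, n))) with hS
  set g : (Σ _ : (Σ _ : ℕ, ℕ → Site 2), (Σ _ : ℕ, ℕ → Site 2)) → (Σ _ : ℕ, ℕ → Site 2) :=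
    fun q => ⟨q.1.1 + 1 + q.2.1,
      Zd.concatWalk q.1.1 q.1.2 (Zd.concatWalk 1 (Zd.straightWalk 2 1) q.2.2)⟩ with hg
  have hL : criticalFugacity * ∑ m ∈ Finset.range (N₁ + 1), ∑ ω ∈ boxAt(w, lo, hi, m),
      criticalFugacity ^ m * bmass(W, LO - ω m 1, HI - ω m 1, N₂) =
      ∑ q ∈ S, criticalFugacity ^ (g q).1 := by
    simp only [hS, Finset.sum_sigma, Finset.mul_sum, hg]
    refine Finset.sum_congr rfl fun m _ => Finset.sum_congr rfl fun ω _ =>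
      Finset.sum_congr rfl fun n _ => Finset.sum_congr rfl fun υ _ => ?_
    ring
  have hR : bmass(w + 1 + W, LO, HI, N₁ + 1 + N₂) =
      ∑ t ∈ (Finset.range (N₁ + 1 + N₂ + 1)).sigma (fun n => boxAt(w + 1 + W, LO, HI, n)),
        criticalFugacity ^ t.1 := by
    rw [Finset.sum_sigma]
  have hinj : Set.InjOn g S := by
    rintro ⟨⟨m, ω⟩, ⟨n, υ⟩⟩ hq ⟨⟨m', ω'⟩, ⟨n', υ'⟩⟩ hq' h
    simp only [Finset.mem_coe, hS, Finset.mem_sigma, Finset.mem_range] at hq hq'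
    simp only [hg, Sigma.mk.inj_iff, heq_eq_eq] at h
    obtain ⟨hlen, hγ⟩ := h
    obtain ⟨rfl, rfl, rfl⟩ :=
      glue_decode hq.1.2 hq'.1.2 (mem_boxAt.1 hq.2.2).1 (mem_boxAt.1 hq'.2.2).1 hγ
    obtain rfl : n = n' := by omega
    rfl
  have hsub : S.image g ⊆
      (Finset.range (N₁ + 1 + N₂ + 1)).sigma (fun n => boxAt(w + 1 + W, LO, HI, n)) := by
    refine Finset.image_subset_iff.2 ?_
    rintro ⟨⟨m, ω⟩, ⟨n, υ⟩⟩ hq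
    simp only [hS, Finset.mem_sigma, Finset.mem_range] at hq
    obtain ⟨⟨hm, hω⟩, hn, hυ⟩ := hq
    simp only [hg, Finset.mem_sigma, Finset.mem_range]
    exact ⟨by omega, glue_mem_boxAt hlo hhi hω hυ⟩
  calc criticalFugacity * ∑ m ∈ Finset.range (N₁ + 1), ∑ ω ∈ boxAt(w, lo, hi, m),
        criticalFugacity ^ m * bmass(W, LO - ω m 1, HI - ω m 1, N₂)
      = ∑ q ∈ S, criticalFugacity ^ (g q).1 := hL
    _ = ∑ t ∈ S.image g, criticalFugacity ^ t.1 :=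
        (Finset.sum_image (f := fun t : (Σ _ : ℕ, ℕ → Site 2) => criticalFugacity ^ t.1) hinj).symm
    _ ≤ ∑ t ∈ (Finset.range (N₁ + 1 + N₂ + 1)).sigma (fun n => boxAt(w + 1 + W, LO, HI, n)),
          criticalFugacity ^ t.1 :=
        Finset.sum_le_sum_of_subset_of_nonneg hsub fun t _ _ => pow_nonneg criticalFugacity_pos.le _
    _ = bmass(w + 1 + W, LO, HI, N₁ + 1 + N₂) := hR.symm

/-- **Gluing multiplies masses** (registered sub-goal form of `glue_mass`, all hypotheses after the colon):
for all widths `w, W`, cut-offs `N₁, N₂` and windows `[lo, hi] ⊆ [LO, HI]`, `x_c` times the sum over heads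
`ω ∈ boxAt(w, lo, hi, m)`, `m ≤ N₁`, of `x_c^m` times the partial mass of the width-`W` box re-centred at the
exit height `ω m 1` is at most the partial mass of `boxAt(w + 1 + W, LO, HI, ·)` at cut-off `N₁ + 1 + N₂`. -/
theorem steeredChain_glue_mass : ∀ (w W N₁ N₂ : ℕ) (lo hi LO HI : ℤ), LO ≤ lo → hi ≤ HI →
    criticalFugacity * ∑ m ∈ Finset.range (N₁ + 1), ∑ ω ∈ boxAt(w, lo, hi, m),
        criticalFugacity ^ m * bmass(W, LO - ω m 1, HI - ω m 1, N₂) ≤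
      bmass(w + 1 + W, LO, HI, N₁ + 1 + N₂) :=
  fun w W N₁ N₂ _ _ _ _ hlo hhi => glue_mass w W N₁ N₂ hlo hhi

end Summit.CriticalPhenomena.SAWScalingLimit.Theorems.TubeLowerBound.LiebSimonStar.SteeredChain

end
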